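import Mathlib
import HarnessLib
import Literature.Analysis.Complex.Montel
import Literature.MathematicalPhysics.QuantumLattice.HubbardFermiLiquid

/-!
# A holomorphic extension of the finite-volume Hubbard two-point function from a bounded MATSUBARA-INDEXED family (Montel in the cutoff)
# — the assembly step of the tree's R0 core, generic in the domain (route-free support module of the K1 Vitali line)

Seat leafhand-hubbard-klprogramme-2 (K1 `H10TwoPointLimit` lead, 2026-08-30).  The tree's complex-coupling engine
(`Literature/…/HubbardBetaUBound`: `norm_hubbardRatio_le_betaUMb`, the Grassmann flow `FlowSetup.Valid`) bounds the finite-`M` Matsubara-cutoff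
ratio `R_{L,M}(u)` on the disc `|u| ≤ κ_U/β` uniformly in `L, M`, and the Matsubara bridge (`tendsto_grassmannTwoPoint_eq_hubbardThermalTwoPoint_sub`)
identifies `lim_M R_{L,M}(U)` with the thermal two-point function minus a constant (`½` on the diagonal) at small real `U`;
`Summits/…/Theorems/KLProgrammeH10RungBetaUCorner.R0_core_at` assembles the per-`L` extension by Montel in `M` ON THE DISC.  Here the same
assembly for ANY open `Ω ∋ 0` and an ABSTRACT family `g_M` (nothing about the Grassmann representation is imported or asserted):

* `extension_of_matsubara_family` — `Ω` open, `0 ∈ Ω`; for `M ≥ M₀`, `g_M` holomorphic on `Ω` with `‖g_M‖ ≤ B`; at small real couplings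
  `0 < |t| < ρ` inside `Ω`, `g_M(t) → ⟨c†_{xσ} c_{yσ'}⟩_{β,L,t,μ} − c` ⟹ a holomorphic `G` on `Ω`, `‖G‖ ≤ B + ‖c‖`, equal to the two-point
  function at `0 < |t| < ρ'` — exactly the per-volume input of `H10VitaliLine.tendsto_hubbardThermalTwoPoint_of_connected_extension_nearZero`.

Everything PROVED; no definition, no named fact. References: BGM 2006 [cite: BenfattoGiulianiMastropietro2006, Thm 2.1, §2.2 footnote 1]; Montel
(Conway VII.2.9) [folklore].
-/

noncomputable section

namespace Summit.HubbardSuperconductivity.HubbardSuperconductivity.Theorems.H10VitaliLine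

set_option linter.dupNamespace false -- summit = problem name (single-conjunct summit), D-0017

open Filter Set Metric Topology Complex
open Literature.MathematicalPhysics.QuantumLattice Literature.Probability.LatticeModels

/-- **A holomorphic extension of the finite-volume two-point function from a bounded Matsubara-indexed family** (the assembly step of
`R0_core_at`, generic in the domain): `Ω` open with `0 ∈ Ω`; for `M ≥ M₀` the `g_M` are complex differentiable on `Ω` and bounded by `B`
there; for small real couplings `0 < |t| < ρ` inside `Ω`, `g_M(t) → ⟨c†_{xσ} c_{yσ'}⟩_{β,L,t,μ} − c` as `M → ∞`.  Then some `G`, complex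
differentiable on `Ω` with `‖G‖ ≤ B + ‖c‖`, agrees with the two-point function at all small non-zero real couplings.
[folklore: Montel + uniqueness of limits] -/
theorem extension_of_matsubara_family {β μ : ℝ} {L : ℕ} {x y : Site 2} {σ σ' : Fin 2} {Ω : Set ℂ} (hΩ : IsOpen Ω)
    (h0 : (0 : ℂ) ∈ Ω) {g : ℕ → ℂ → ℂ} {M₀ : ℕ} {B : ℝ} {c : ℂ} {ρ : ℝ} (hρ : 0 < ρ)
    (hg : ∀ M, M₀ ≤ M → DifferentiableOn ℂ (g M) Ω) (hB : ∀ M, M₀ ≤ M → ∀ z ∈ Ω, ‖g M z‖ ≤ B)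
    (hlim : ∀ t : ℝ, 0 < |t| → |t| < ρ → ((t : ℝ) : ℂ) ∈ Ω →
      Tendsto (fun M : ℕ => g M (t : ℂ)) atTop (𝓝 (hubbardThermalTwoPoint β t μ L x y σ σ' - c))) :
    ∃ G : ℂ → ℂ, DifferentiableOn ℂ G Ω ∧ (∀ z ∈ Ω, ‖G z‖ ≤ B + ‖c‖) ∧
      ∃ ρ' : ℝ, 0 < ρ' ∧ ∀ t : ℝ, 0 < |t| → |t| < ρ' → G (t : ℂ) = hubbardThermalTwoPoint β t μ L x y σ σ' := by
  -- the shifted family `n ↦ g (M₀ + n)` and its Montel subsequence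
  set F : ℕ → ℂ → ℂ := fun n => g (M₀ + n) with hF
  have hF' : ∀ n, DifferentiableOn ℂ (F n) Ω := fun n => hg (M₀ + n) (Nat.le_add_right _ _)
  have hFB : ∀ n, ∀ z ∈ Ω, ‖F n z‖ ≤ B := fun n z hz => hB (M₀ + n) (Nat.le_add_right _ _) z hz
  obtain ⟨G₀, φ, hφ, hG₀, hconv, -⟩ := Complex.exists_strictMono_tendstoLocallyUniformlyOn_of_norm_le hΩ hF' hFB
  -- a small ball about `0` inside `Ω`
  obtain ⟨ε, hε, hball⟩ := Metric.isOpen_iff.1 hΩ 0 h0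
  refine ⟨fun z => G₀ z + c, hG₀.add_const c, fun z hz => ?_, min ρ ε, lt_min hρ hε, fun t ht0 ht => ?_⟩
  · -- the bound passes to the locally uniform limit
    have hb : ‖G₀ z‖ ≤ B := le_of_tendsto' ((hconv.tendsto_at hz).norm) fun n => hFB _ z hz
    exact (norm_add_le _ _).trans (by linarith)
  · -- agreement at small real couplings: the subsequence limit is the full `M → ∞` limit
    have htρ : |t| < ρ := lt_of_lt_of_le ht (min_le_left _ _)
    have htΩ : ((t : ℝ) : ℂ) ∈ Ω := by
      apply hball
      rw [Metric.mem_ball, dist_zero_right, Complex.norm_real, Real.norm_eq_abs]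
      exact lt_of_lt_of_le ht (min_le_right _ _)
    have h1 : Tendsto (fun n => F (φ n) (t : ℂ)) atTop (𝓝 (G₀ (t : ℂ))) := hconv.tendsto_at htΩ
    have h2 : Tendsto (fun n => F (φ n) (t : ℂ)) atTop (𝓝 (hubbardThermalTwoPoint β t μ L x y σ σ' - c)) := by
      have hM : Tendsto (fun n => M₀ + φ n) atTop atTop :=
        tendsto_atTop_atTop.2 fun b => ⟨b, fun n hn => le_add_left (hn.trans (hφ.id_le n))⟩
      exact (hlim t ht0 htρ htΩ).comp hM
    show G₀ (t : ℂ) + c = _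
    rw [tendsto_nhds_unique h1 h2, sub_add_cancel]

end Summit.HubbardSuperconductivity.HubbardSuperconductivity.Theorems.H10VitaliLine

end
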